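import Mathlib

/-!
# A Gaussian upper bound for binomial coefficients with the sharp exponent:
# `(2n+1) · binom(2n, n+p)² · e^{2p²/n} ≤ 16ⁿ` for `0 ≤ p < n`

This is the numerical inequality behind the last step (part (c)) of the Schur / Erdős–Turán bound on the number of positive
zeros of a polynomial as presented in [cite: BorweinErdelyi1995, §1.2 E.7(c)]:
`log (4ⁿ / (√(2n+1) · binom(2n, n+m))) ≥ m²/n`.  NOTE (print erratum recorded here, proved around): as printed — for ALL
`0 ≤ m ≤ n` — that display is FALSE at `(n,m) = (1,1)` (`log(4/√3) ≈ 0.837 < 1`) and `(2,2)` (`log(16/√5) ≈ 1.968 < 2`)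
and true otherwise; we prove it for `m < n` (all `n ≥ 1`), which is what the application needs (the case `m = n`, all
roots positive, is settled there directly).  Squared and exponentiated form: `(2n+1) · binom(2n,n+p)² · exp(2p²/n) ≤ 16ⁿ`.

Proof.  `binom(2n,n+p) = binom(2n,n) · ∏_{j<p} (n−j)/(n+j+1)` and, with `u_j = (2j+1)/(2n+1)`,
`(n−j)/(n+j+1) = (1−u_j)/(1+u_j) ≤ exp(−2u_j − (2/3)u_j³)` (two terms of the `artanh` series,
`Real.hasSum_log_sub_log_of_abs_lt_one`).  Since `p² = Σ_{j<p} (2j+1)` and `(2j+1)/n − 2u_j = u_j/n`, this gives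
`binom(2n,n+p)² e^{2p²/n} ≤ binom(2n,n)² · exp(2 Σ_{j<p} (u_j/n − (2/3)u_j³)) ≤ binom(2n,n)² · exp(4/(3√(2n)))`
(each summand is `≤ 2/(3n√(2n))`: `3t − t³ ≤ 2` for `t = √(2n)·u ≥ 0`).  With the classical
`binom(2n,n)² (3n+1) ≤ 16ⁿ` and `exp(4/(3√(2n))) ≤ (3n+1)/(2n+1)` for `n ≥ 7` (again two `artanh` terms) the claim
follows for `n ≥ 7`; the `21` cases `p < n ≤ 6` are checked by `norm_num` with `e < 2.7182818286`.

Mathlib only; everything here is proved (no named facts).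
-/

noncomputable section

open Finset Real

namespace Literature.Analysis.SpecialFunctions

namespace BinomialGaussian

/-- The classical central binomial bound `binom(2n,n) ≤ 4ⁿ/√(3n+1)`, squared: `binom(2n,n)²·(3n+1) ≤ 16ⁿ`. [folklore] -/
private theorem centralBinom_sq_mul_le (n : ℕ) : ((Nat.centralBinom n : ℝ)) ^ 2 * (3 * n + 1) ≤ 16 ^ n := by
  induction n with
  | zero => simp
  | succ k ih =>
    have hrec : ((k : ℝ) + 1) * (Nat.centralBinom (k + 1) : ℝ) = 2 * (2 * k + 1) * (Nat.centralBinom k : ℝ) := by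
      exact_mod_cast Nat.succ_mul_centralBinom_succ k
    have hk : (0 : ℝ) ≤ k := Nat.cast_nonneg k
    have hc : (0 : ℝ) ≤ (Nat.centralBinom k : ℝ) := Nat.cast_nonneg _
    -- `(k+1)² c_{k+1}² (3k+4) = 4(2k+1)² (3k+4) c_k² ≤ 16 (k+1)² (3k+1) c_k² ≤ 16^{k+1} (k+1)²`
    have hpoly : (2 * (k : ℝ) + 1) ^ 2 * (3 * k + 4) ≤ 4 * ((k : ℝ) + 1) ^ 2 * (3 * k + 1) := by nlinarith
    have h1 : (((k : ℝ) + 1) * (Nat.centralBinom (k + 1) : ℝ)) ^ 2 * (3 * ((k : ℝ) + 1) + 1)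
        ≤ 16 ^ (k + 1) * ((k : ℝ) + 1) ^ 2 := by
      rw [hrec]
      have h2 : (2 * (2 * (k : ℝ) + 1) * (Nat.centralBinom k : ℝ)) ^ 2 * (3 * ((k : ℝ) + 1) + 1)
          = 4 * ((2 * (k : ℝ) + 1) ^ 2 * (3 * k + 4)) * (Nat.centralBinom k : ℝ) ^ 2 := by ring
      rw [h2, show (16 : ℝ) ^ (k + 1) = 16 ^ k * 16 from pow_succ 16 k]
      nlinarith [mul_le_mul_of_nonneg_right hpoly (sq_nonneg (Nat.centralBinom k : ℝ)),
        mul_le_mul_of_nonneg_left ih (by positivity : (0 : ℝ) ≤ 16 * ((k : ℝ) + 1) ^ 2)]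
    have hk1 : (0 : ℝ) < ((k : ℝ) + 1) ^ 2 := by positivity
    push_cast
    nlinarith [h1, hk1]

/-- Two terms of the `artanh` series: `2u + (2/3)u³ ≤ log(1+u) − log(1−u)` for `0 ≤ u < 1`. [folklore] -/
private theorem two_mul_add_le_log_sub_log {u : ℝ} (h0 : 0 ≤ u) (h1 : u < 1) :
    2 * u + 2 / 3 * u ^ 3 ≤ Real.log (1 + u) - Real.log (1 - u) := by
  have habs : |u| < 1 := abs_lt.2 ⟨by linarith, h1⟩
  have hs := Real.hasSum_log_sub_log_of_abs_lt_one habs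
  have hle := sum_le_hasSum (Finset.range 2) (fun k _ => by positivity) hs
  simp only [Finset.sum_range_succ, Finset.sum_range_zero] at hle
  norm_num at hle
  linarith

/-- `(1−u)/(1+u) ≤ exp(−(2u + (2/3)u³))` for `0 ≤ u < 1`. [folklore] -/
private theorem div_le_exp_neg {u : ℝ} (h0 : 0 ≤ u) (h1 : u < 1) :
    (1 - u) / (1 + u) ≤ Real.exp (-(2 * u + 2 / 3 * u ^ 3)) := by
  have hpos1 : 0 < 1 + u := by linarith
  have hpos2 : 0 < 1 - u := by linarith
  have hlog := two_mul_add_le_log_sub_log h0 h1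
  have hexp : Real.exp (2 * u + 2 / 3 * u ^ 3) ≤ (1 + u) / (1 - u) := by
    calc Real.exp (2 * u + 2 / 3 * u ^ 3) ≤ Real.exp (Real.log (1 + u) - Real.log (1 - u)) :=
          Real.exp_le_exp.2 hlog
      _ = (1 + u) / (1 - u) := by rw [Real.exp_sub, Real.exp_log hpos1, Real.exp_log hpos2]
  rw [Real.exp_neg]
  have hq : 0 < (1 + u) / (1 - u) := div_pos hpos1 hpos2
  calc (1 - u) / (1 + u) = ((1 + u) / (1 - u))⁻¹ := by rw [inv_div]
    _ ≤ (Real.exp (2 * u + 2 / 3 * u ^ 3))⁻¹ := by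
        exact inv_anti₀ (Real.exp_pos _) hexp

/-- `binom(2n, n+p) = binom(2n, n) · ∏_{j<p} (n−j)/(n+j+1)` (`p ≤ n`). [folklore] -/
private theorem choose_eq_centralBinom_mul_prod (n p : ℕ) (hp : p ≤ n) :
    (Nat.choose (2 * n) (n + p) : ℝ) = (Nat.centralBinom n : ℝ) * ∏ j ∈ range p, (((n : ℝ) - j) / ((n : ℝ) + j + 1)) := by
  induction p with
  | zero => simp [Nat.centralBinom_eq_two_mul_choose]
  | succ q ih =>
    have hq : q ≤ n := Nat.le_of_succ_le hp
    have hrec : (Nat.choose (2 * n) (n + q + 1) : ℝ) * ((n : ℝ) + q + 1) = (Nat.choose (2 * n) (n + q) : ℝ) * ((n : ℝ) - q) := by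
      have h := Nat.choose_succ_right_eq (2 * n) (n + q)
      have h' : ((Nat.choose (2 * n) (n + q + 1) * (n + q + 1) : ℕ) : ℝ) = ((Nat.choose (2 * n) (n + q) * (2 * n - (n + q)) : ℕ) : ℝ) := by
        exact_mod_cast h
      push_cast [Nat.cast_sub (show n + q ≤ 2 * n by omega)] at h'
      linear_combination h'
    have hne : ((n : ℝ) + q + 1) ≠ 0 := by positivity
    rw [Finset.prod_range_succ, ← mul_assoc, ← ih hq, show n + (q + 1) = n + q + 1 by ring]
    field_simp
    linear_combination hrec

/-- `Σ_{j<p} (2j+1) = p²`. [folklore] -/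
private theorem sum_range_two_mul_add_one (p : ℕ) : ∑ j ∈ range p, (2 * (j : ℝ) + 1) = (p : ℝ) ^ 2 := by
  induction p with
  | zero => simp
  | succ q ih => rw [Finset.sum_range_succ, ih]; push_cast; ring

/-- The cubic estimate: `2u/s² − (2/3)u³ ≤ 4/(3s³)` for `s > 0`, `u ≥ 0` (i.e. `3t − t³ ≤ 2` at `t = su`). [folklore] -/
private theorem phi_le {s u : ℝ} (hs : 0 < s) (hu : 0 ≤ u) : 2 * u / s ^ 2 - 2 / 3 * u ^ 3 ≤ 4 / (3 * s ^ 3) := by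
  have key : 0 ≤ (s * u - 1) ^ 2 * (s * u + 2) := by positivity
  have h1 : 6 * (s * u) - 2 * (s * u) ^ 3 ≤ 4 := by nlinarith [key]
  have hs3 : 0 < 3 * s ^ 3 := by positivity
  have hrew : 2 * u / s ^ 2 - 2 / 3 * u ^ 3 = (6 * (s * u) - 2 * (s * u) ^ 3) / (3 * s ^ 3) := by
    field_simp
    ring
  rw [hrew]
  exact div_le_div_of_nonneg_right h1 hs3.le

/-- **The analytic range `n ≥ 7`** (all `p ≤ n`): `(2n+1)·binom(2n,n+p)²·exp(2p²/n) ≤ 16ⁿ`. [folklore] -/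
private theorem choose_sq_mul_exp_le_of_seven_le (n p : ℕ) (hn : 7 ≤ n) (hp : p ≤ n) :
    (2 * (n : ℝ) + 1) * (Nat.choose (2 * n) (n + p) : ℝ) ^ 2 * Real.exp (2 * (p : ℝ) ^ 2 / n) ≤ 16 ^ n := by
  have hN7 : (7 : ℝ) ≤ (n : ℝ) := by exact_mod_cast hn
  have hN : (0 : ℝ) < n := by linarith
  set s : ℝ := Real.sqrt (2 * (n : ℝ)) with hsdef
  have hs : 0 < s := Real.sqrt_pos.2 (by linarith)
  have hs2 : s ^ 2 = 2 * (n : ℝ) := Real.sq_sqrt (by linarith)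
  set u : ℕ → ℝ := fun j => (2 * (j : ℝ) + 1) / (2 * (n : ℝ) + 1) with hudef
  have hu0 : ∀ j : ℕ, 0 ≤ u j := fun j => by rw [hudef]; positivity
  have hu1 : ∀ j : ℕ, j < n → u j < 1 := by
    intro j hj
    have : (j : ℝ) + 1 ≤ (n : ℝ) := by exact_mod_cast hj
    rw [hudef]; dsimp only
    rw [div_lt_one (by linarith)]
    linarith
  -- the factors `(n-j)/(n+j+1) = (1-u_j)/(1+u_j) ≤ exp(-(2u_j + (2/3)u_j³))`
  have hfac : ∀ j : ℕ, j < n →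
      (((n : ℝ) - j) / ((n : ℝ) + j + 1)) ≤ Real.exp (-(2 * u j + 2 / 3 * (u j) ^ 3)) := by
    intro j hj
    have hq : ((n : ℝ) - j) / ((n : ℝ) + j + 1) = (1 - u j) / (1 + u j) := by
      rw [hudef]; dsimp only
      have h2N : (2 * (n : ℝ) + 1) ≠ 0 := by linarith
      have hden : (n : ℝ) + j + 1 ≠ 0 := by have : (0:ℝ) ≤ j := Nat.cast_nonneg j; linarith
      field_simp
      ring
    rw [hq]
    exact div_le_exp_neg (hu0 j) (hu1 j hj)
  have hfac_nonneg : ∀ j : ℕ, j < n → 0 ≤ ((n : ℝ) - j) / ((n : ℝ) + j + 1) := by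
    intro j hj
    have : (j : ℝ) + 1 ≤ (n : ℝ) := by exact_mod_cast hj
    have : (0 : ℝ) ≤ j := Nat.cast_nonneg j
    exact div_nonneg (by linarith) (by linarith)
  -- `r := ∏_{j<p} (n-j)/(n+j+1) ≤ exp (Σ -(…))`
  set r : ℝ := ∏ j ∈ range p, (((n : ℝ) - j) / ((n : ℝ) + j + 1)) with hrdef
  have hr0 : 0 ≤ r :=
    Finset.prod_nonneg fun j hj => hfac_nonneg j (lt_of_lt_of_le (Finset.mem_range.1 hj) hp)
  have hr : r ≤ Real.exp (∑ j ∈ range p, -(2 * u j + 2 / 3 * (u j) ^ 3)) := by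
    rw [Real.exp_sum]
    exact Finset.prod_le_prod (fun j hj => hfac_nonneg j (lt_of_lt_of_le (Finset.mem_range.1 hj) hp))
      (fun j hj => hfac j (lt_of_lt_of_le (Finset.mem_range.1 hj) hp))
  -- exponent bookkeeping: `p²/n + Σ -(2u+(2/3)u³) = Σ (2u/s² - (2/3)u³) ≤ p·4/(3s³) ≤ 2/(3s)`
  have hterm : ∀ j : ℕ, (2 * (j : ℝ) + 1) / (n : ℝ) - (2 * u j + 2 / 3 * (u j) ^ 3)
      = 2 * u j / s ^ 2 - 2 / 3 * (u j) ^ 3 := by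
    intro j
    rw [hs2, hudef]; dsimp only
    have h2N : (2 * (n : ℝ) + 1) ≠ 0 := by linarith
    field_simp
    ring
  have hsumexp : (p : ℝ) ^ 2 / n + ∑ j ∈ range p, -(2 * u j + 2 / 3 * (u j) ^ 3) ≤ 2 / (3 * s) := by
    have hrw : (p : ℝ) ^ 2 / n + ∑ j ∈ range p, -(2 * u j + 2 / 3 * (u j) ^ 3)
        = ∑ j ∈ range p, (2 * u j / s ^ 2 - 2 / 3 * (u j) ^ 3) := by
      rw [← sum_range_two_mul_add_one p, Finset.sum_div, ← Finset.sum_add_distrib]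
      refine Finset.sum_congr rfl fun j _ => ?_
      rw [← hterm j]
      ring
    rw [hrw]
    calc ∑ j ∈ range p, (2 * u j / s ^ 2 - 2 / 3 * (u j) ^ 3)
        ≤ ∑ j ∈ range p, (4 / (3 * s ^ 3)) := Finset.sum_le_sum fun j _ => phi_le hs (hu0 j)
      _ = p * (4 / (3 * s ^ 3)) := by rw [Finset.sum_const, Finset.card_range, nsmul_eq_mul]
      _ ≤ (n : ℝ) * (4 / (3 * s ^ 3)) := by
          have : (p : ℝ) ≤ n := by exact_mod_cast hp
          exact mul_le_mul_of_nonneg_right this (by positivity)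
      _ = 2 / (3 * s) := by
          have hs3 : s ^ 3 = 2 * (n : ℝ) * s := by rw [pow_succ, hs2]
          rw [hs3]
          field_simp
          norm_num
  -- hence `r² · exp(2p²/n) ≤ exp(4/(3s))`
  have hmain1 : r ^ 2 * Real.exp (2 * (p : ℝ) ^ 2 / n) ≤ Real.exp (4 / (3 * s)) := by
    have hA : r ^ 2 ≤ Real.exp (∑ j ∈ range p, -(2 * u j + 2 / 3 * (u j) ^ 3)) ^ 2 :=
      pow_le_pow_left₀ hr0 hr 2
    calc r ^ 2 * Real.exp (2 * (p : ℝ) ^ 2 / n)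
        ≤ Real.exp (∑ j ∈ range p, -(2 * u j + 2 / 3 * (u j) ^ 3)) ^ 2 * Real.exp (2 * (p : ℝ) ^ 2 / n) :=
          mul_le_mul_of_nonneg_right hA (Real.exp_pos _).le
      _ = Real.exp (2 * ((p : ℝ) ^ 2 / n + ∑ j ∈ range p, -(2 * u j + 2 / 3 * (u j) ^ 3))) := by
          rw [← Real.exp_nat_mul, ← Real.exp_add]
          congr 1
          push_cast
          ring
      _ ≤ Real.exp (2 * (2 / (3 * s))) := Real.exp_le_exp.2 (by nlinarith [hsumexp])
      _ = Real.exp (4 / (3 * s)) := by congr 1; ring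
  -- `exp(4/(3s)) ≤ (3n+1)/(2n+1)`
  have hmain2 : Real.exp (4 / (3 * s)) ≤ (3 * (n : ℝ) + 1) / (2 * (n : ℝ) + 1) := by
    set w : ℝ := (n : ℝ) / (5 * (n : ℝ) + 2) with hwdef
    have hw0 : 0 ≤ w := by rw [hwdef]; positivity
    have hw1 : w < 1 := by rw [hwdef, div_lt_one (by linarith)]; linarith
    have h5 : (5 * (n : ℝ) + 2) ≠ 0 := by linarith
    have hratio : (3 * (n : ℝ) + 1) / (2 * (n : ℝ) + 1) = (1 + w) / (1 - w) := by
      have h1w : 1 + w = (6 * (n : ℝ) + 2) / (5 * (n : ℝ) + 2) := by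
        rw [hwdef, eq_div_iff h5]; field_simp; ring
      have h2w : 1 - w = (4 * (n : ℝ) + 2) / (5 * (n : ℝ) + 2) := by
        rw [hwdef, eq_div_iff h5]; field_simp; ring
      rw [h1w, h2w, div_div_div_cancel_right₀ h5, div_eq_div_iff (by linarith) (by linarith)]
      ring
    have hsq : (2 * (5 * (n : ℝ) + 2)) ^ 2 ≤ (3 * (n : ℝ) * s) ^ 2 := by
      have : (3 * (n : ℝ) * s) ^ 2 = 18 * (n : ℝ) ^ 3 := by rw [mul_pow, hs2]; ring
      rw [this]
      nlinarith [mul_nonneg (mul_nonneg hN.le hN.le) (by linarith : (0:ℝ) ≤ (n : ℝ) - 7)]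
    have hlin : 2 * (5 * (n : ℝ) + 2) ≤ 3 * (n : ℝ) * s :=
      (pow_le_pow_iff_left₀ (by positivity) (by positivity) two_ne_zero).1 hsq
    have hle2w : 4 / (3 * s) ≤ 2 * w := by
      rw [hwdef, mul_div_assoc', div_le_div_iff₀ (by positivity) (by positivity)]
      nlinarith [hlin]
    have hpos1 : 0 < 1 + w := by linarith
    have hpos2 : 0 < 1 - w := by linarith
    calc Real.exp (4 / (3 * s)) ≤ Real.exp (2 * w) := Real.exp_le_exp.2 hle2w
      _ ≤ Real.exp (2 * w + 2 / 3 * w ^ 3) := Real.exp_le_exp.2 (by nlinarith [pow_nonneg hw0 3])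
      _ ≤ Real.exp (Real.log (1 + w) - Real.log (1 - w)) := Real.exp_le_exp.2 (two_mul_add_le_log_sub_log hw0 hw1)
      _ = (1 + w) / (1 - w) := by rw [Real.exp_sub, Real.exp_log hpos1, Real.exp_log hpos2]
      _ = (3 * (n : ℝ) + 1) / (2 * (n : ℝ) + 1) := hratio.symm
  -- assemble
  have hcb := centralBinom_sq_mul_le n
  have hC : (Nat.choose (2 * n) (n + p) : ℝ) = (Nat.centralBinom n : ℝ) * r := by
    rw [hrdef]; exact choose_eq_centralBinom_mul_prod n p hp
  have h2n : (0 : ℝ) < 2 * (n : ℝ) + 1 := by linarith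
  have h3n : (0 : ℝ) < 3 * (n : ℝ) + 1 := by linarith
  calc (2 * (n : ℝ) + 1) * (Nat.choose (2 * n) (n + p) : ℝ) ^ 2 * Real.exp (2 * (p : ℝ) ^ 2 / n)
      = (2 * (n : ℝ) + 1) * (Nat.centralBinom n : ℝ) ^ 2 * (r ^ 2 * Real.exp (2 * (p : ℝ) ^ 2 / n)) := by
        rw [hC]; ring
    _ ≤ (2 * (n : ℝ) + 1) * (Nat.centralBinom n : ℝ) ^ 2 * ((3 * (n : ℝ) + 1) / (2 * (n : ℝ) + 1)) :=
        mul_le_mul_of_nonneg_left (hmain1.trans hmain2) (by positivity)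
    _ = (Nat.centralBinom n : ℝ) ^ 2 * (3 * (n : ℝ) + 1) := by field_simp
    _ ≤ 16 ^ n := hcb

/-- Reduction of the claim for one `(n,p)` to a decidable numerical inequality, using `e < 2.7182818286`:
`((2n+1)·C²)ⁿ · 2.7182818286^{2p²} ≤ 16^{n·n}` implies `(2n+1)·C²·exp(2p²/n) ≤ 16ⁿ`. [folklore] -/
private theorem choose_sq_mul_exp_le_of_numeric (n p : ℕ) (hn : 1 ≤ n)
    (h : ((2 * (n : ℝ) + 1) * (Nat.choose (2 * n) (n + p) : ℝ) ^ 2) ^ n * (2.7182818286 : ℝ) ^ (2 * p ^ 2)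
      ≤ 16 ^ (n * n)) :
    (2 * (n : ℝ) + 1) * (Nat.choose (2 * n) (n + p) : ℝ) ^ 2 * Real.exp (2 * (p : ℝ) ^ 2 / n) ≤ 16 ^ n := by
  have hn0 : (n : ℝ) ≠ 0 := by exact_mod_cast (Nat.one_le_iff_ne_zero.1 hn)
  have hL : 0 ≤ (2 * (n : ℝ) + 1) * (Nat.choose (2 * n) (n + p) : ℝ) ^ 2 * Real.exp (2 * (p : ℝ) ^ 2 / n) := by
    positivity
  rw [← pow_le_pow_iff_left₀ hL (by positivity) (Nat.one_le_iff_ne_zero.1 hn), ← pow_mul, mul_pow]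
  refine le_trans (mul_le_mul_of_nonneg_left ?_ (by positivity)) h
  rw [← Real.exp_nat_mul, show (n : ℝ) * (2 * (p : ℝ) ^ 2 / n) = ((2 * p ^ 2 : ℕ) : ℝ) * 1 by
    push_cast; field_simp, Real.exp_nat_mul]
  exact pow_le_pow_left₀ (Real.exp_pos 1).le Real.exp_one_lt_d9.le _

/-- **The small range `p < n ≤ 6`** (21 cases, `norm_num`). [folklore] -/
private theorem choose_sq_mul_exp_le_of_le_six (n p : ℕ) (hn : 1 ≤ n) (hn6 : n ≤ 6) (hp : p < n) :
    (2 * (n : ℝ) + 1) * (Nat.choose (2 * n) (n + p) : ℝ) ^ 2 * Real.exp (2 * (p : ℝ) ^ 2 / n) ≤ 16 ^ n := by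
  apply choose_sq_mul_exp_le_of_numeric n p hn
  interval_cases n <;> interval_cases p <;> norm_num [Nat.choose]

/-- **`(2n+1) · binom(2n, n+p)² · e^{2p²/n} ≤ 16ⁿ` for all `0 ≤ p < n`** — equivalently
`p²/n ≤ log(4ⁿ/(√(2n+1)·binom(2n,n+p)))`, valid for `m = p < n` (see the module docstring for the two printed
exceptions `(1,1)`, `(2,2)` at `m = n`). [cite: BorweinErdelyi1995, §1.2 E.7(c)] -/
theorem choose_sq_mul_exp_le (n p : ℕ) (hn : 1 ≤ n) (hp : p < n) :
    (2 * (n : ℝ) + 1) * (Nat.choose (2 * n) (n + p) : ℝ) ^ 2 * Real.exp (2 * (p : ℝ) ^ 2 / n) ≤ 16 ^ n := by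
  rcases le_or_gt 7 n with h7 | h7
  · exact choose_sq_mul_exp_le_of_seven_le n p h7 hp.le
  · exact choose_sq_mul_exp_le_of_le_six n p hn (by omega) hp

/-- Logarithmic form, as printed in [cite: BorweinErdelyi1995, §1.2 E.7(c)] (for `p < n`):
`p²/n ≤ log (4ⁿ / (√(2n+1) · binom(2n, n+p)))`. -/
theorem sq_div_le_log (n p : ℕ) (hn : 1 ≤ n) (hp : p < n) :
    (p : ℝ) ^ 2 / n ≤ Real.log ((4 : ℝ) ^ n / (Real.sqrt (2 * n + 1) * (Nat.choose (2 * n) (n + p) : ℝ))) := by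
  have h := choose_sq_mul_exp_le n p hn hp
  have hC : (0 : ℝ) < (Nat.choose (2 * n) (n + p) : ℝ) := by exact_mod_cast Nat.choose_pos (by omega)
  have hsq : (0 : ℝ) < Real.sqrt (2 * n + 1) := Real.sqrt_pos.2 (by positivity)
  have hQ : 0 < (4 : ℝ) ^ n / (Real.sqrt (2 * n + 1) * (Nat.choose (2 * n) (n + p) : ℝ)) := by positivity
  rw [Real.le_log_iff_exp_le hQ]
  -- square both sides: exp(p²/n)² = exp(2p²/n) ≤ 16ⁿ/((2n+1) C²) = Q²
  have hQsq : ((4 : ℝ) ^ n / (Real.sqrt (2 * n + 1) * (Nat.choose (2 * n) (n + p) : ℝ))) ^ 2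
      = 16 ^ n / ((2 * n + 1) * (Nat.choose (2 * n) (n + p) : ℝ) ^ 2) := by
    rw [div_pow, mul_pow, Real.sq_sqrt (by positivity), ← pow_mul, show (4 : ℝ) ^ (n * 2) = 16 ^ n by
      rw [mul_comm, pow_mul]; norm_num]
  refine (pow_le_pow_iff_left₀ (Real.exp_pos _).le hQ.le two_ne_zero).1 ?_
  rw [hQsq, ← Real.exp_nat_mul, le_div_iff₀ (by positivity)]
  push_cast
  calc Real.exp (2 * ((p : ℝ) ^ 2 / n)) * ((2 * n + 1) * (Nat.choose (2 * n) (n + p) : ℝ) ^ 2)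
      = (2 * (n : ℝ) + 1) * (Nat.choose (2 * n) (n + p) : ℝ) ^ 2 * Real.exp (2 * (p : ℝ) ^ 2 / n) := by
        rw [mul_div_assoc']; ring
    _ ≤ 16 ^ n := h

end BinomialGaussian

end Literature.Analysis.SpecialFunctions

end
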